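import Mathlib.Tactic

/-!
# Venture HSemireg — LI-2 sign law at n = 4: the centred pair-sum family in closed form
(pub-hsemireg, W2 seat w2-vm-2, gen 20; memo `widen/W2/w2vm2/li2sign/LI2-SIGNLAW-SECOND-w2vm2g20.md` v1.2 §5d)

HONEST FRAMING. Kernel bookkeeping for ONE explicit one-parameter family of solutions of gs-eng-2 g41's
n = 4 «clean triple» (memo `general-structure/XCHECK-LI2-gs2.md` v1.5 §6g: two quadruples of real linear forms
`L`, `L'` on `ℝ²` with `e_d(L') = u·e_d(L)`, `d = 1,2,3`; defect `D = e₄(L') − u·e₄(L)`; SIGN LAW (their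
CONJECTURE): `J(D)·(1 − u) > 0`, `J` the catalecticant).  This file proves the sign law ON THAT FAMILY ONLY, as
polynomial identities plus one positivity statement.  It does not touch the conjecture off the family, constructs no
sheaf, cycle or semiregularity map, moves no census ∕ door ∕ tier word of row LI-2 (stmt 18881), and nothing here says
that HC, HC_CM or HC_AV holds.  RECORD tier; theorems only (0 `def`, 0 `sorry`, 0 named fact).

THE FAMILY (memo §5b–§5d).  A centred quadruple of root forms `m₁..m₄` (`Σ mₖ = 0`) is determined by its three
pair sums `σ₁₂ = m₁+m₂`, `σ₁₃`, `σ₁₄` via `m₁ = (σ₁₂+σ₁₃+σ₁₄)/2`.  Take the pair sums `(a, w, λ·a)` (two of them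
parallel).  Everything below is stated for the VALUES of the forms at an arbitrary point of the plane (scalars
`a w : ℝ`), which is how identities of binary forms are checked coefficient-free; §4–§5 then pass to coefficients
for the discriminant and the catalecticant.
* §1 `e₂ = −(w² + (1+λ²)a²)/2`, `e₃ = λ·a²·w` (the pair-sum lemma `e₃ = σ₁₂(m₃m₄ − m₁m₂)`), and
  `e₄ = ((w² − (1+λ²)a²)² − 4λ²a⁴)/16`.
* §2 the partner: pair sums `(α·a, v·w, β·a)` with `u = v²`, `α⁴ − u(1+λ²)α² + uλ² = 0` and `β·α² = v·λ`
  (so `β = √u·λ/α²`; `α ≠ 0`): then `e₂' = u·e₂` and `e₃' = u·e₃` — the clean triple (`e₁ = e₁' = 0`).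
* §3 the defect is a perfect square: `e₄' − u·e₄ = (u(u−1)/16)·q²` with `q = w² − (1+λ²)a²`.
* §4 in coordinates `a = a₁y₁ + a₂y₂`, `w = w₁y₁ + w₂y₂`: `disc(q) = 4(1+λ²)(a₁w₂ − a₂w₁)²`.
* §5 for any binary quadratic `q = q₀y₁² + q₁y₁y₂ + q₂y₂²` and scalar `c`, the catalecticant of `c·q²` is
  `−c³·disc(q)³/216`; hence on the family `J(D)·(1 − u) = u³(1−u)⁴(1+λ²)³(a₁w₂ − a₂w₁)⁶/13824`,
* §6 which is `> 0` over `ℝ` for `u > 0`, `u ≠ 1`, `a ∦ w`.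
Machine side (not formalised): the same numbers to ≤ 5·10⁻¹⁴ at `u = 0.3 … 12` on two rational red quadruples
(memo §5d); reality of the partner needs `u ≥ 4λ²/(1+λ²)²` (real `α`), outside this file's scope.
-/

namespace Summit.Ventures.HSemireg.LI2CentredPairSumFamily

section identities

/-! All identities are stated over `ℝ` (the forms are real; `ring` then also handles the numeral denominators). -/

/-! ## §1 The centred quadruple with pair sums `(a, w, λa)` -/

/-- Elementary symmetric function `e₂` of the four root values with pair sums `a, w, lam·a`. -/
theorem e2_pairSum (a w lam : ℝ) :
    let m₁ := (a + w + lam * a) / 2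
    let m₂ := a - m₁
    let m₃ := w - m₁
    let m₄ := lam * a - m₁
    m₁ * m₂ + m₁ * m₃ + m₁ * m₄ + m₂ * m₃ + m₂ * m₄ + m₃ * m₄ = -(w ^ 2 + (1 + lam ^ 2) * a ^ 2) / 2 := by
  intro m₁ m₂ m₃ m₄
  simp only [m₁, m₂, m₃, m₄]
  ring

/-- `e₃` of the same quadruple: the pair-sum lemma `e₃ = (m₁+m₂)(m₃m₄ − m₁m₂)` specialised, `= lam·a²·w`. -/
theorem e3_pairSum (a w lam : ℝ) :
    let m₁ := (a + w + lam * a) / 2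
    let m₂ := a - m₁
    let m₃ := w - m₁
    let m₄ := lam * a - m₁
    m₁ * m₂ * m₃ + m₁ * m₂ * m₄ + m₁ * m₃ * m₄ + m₂ * m₃ * m₄ = lam * a ^ 2 * w := by
  intro m₁ m₂ m₃ m₄
  simp only [m₁, m₂, m₃, m₄]
  ring

/-- `e₄` of the same quadruple. -/
theorem e4_pairSum (a w lam : ℝ) :
    let m₁ := (a + w + lam * a) / 2
    let m₂ := a - m₁
    let m₃ := w - m₁
    let m₄ := lam * a - m₁
    m₁ * m₂ * m₃ * m₄ = ((w ^ 2 - (1 + lam ^ 2) * a ^ 2) ^ 2 - 4 * lam ^ 2 * a ^ 4) / 16 := by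
  intro m₁ m₂ m₃ m₄
  simp only [m₁, m₂, m₃, m₄]
  ring

/-- The four values sum to zero (the quadruple is centred). -/
theorem e1_pairSum (a w lam : ℝ) :
    let m₁ := (a + w + lam * a) / 2
    let m₂ := a - m₁
    let m₃ := w - m₁
    let m₄ := lam * a - m₁
    m₁ + m₂ + m₃ + m₄ = 0 := by
  intro m₁ m₂ m₃ m₄
  simp only [m₁, m₂, m₃, m₄]
  ring

/-- The general pair-sum lemma behind the method of the memo (§2 (2)): if four values sum to zero then
`e₃ = (m₁ + m₂)·(m₃m₄ − m₁m₂)`. -/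
theorem e3_eq_pairSum_mul (m₁ m₂ m₃ m₄ : ℝ) (h : m₁ + m₂ + m₃ + m₄ = 0) :
    m₁ * m₂ * m₃ + m₁ * m₂ * m₄ + m₁ * m₃ * m₄ + m₂ * m₃ * m₄ = (m₁ + m₂) * (m₃ * m₄ - m₁ * m₂) := by
  have h4 : m₄ = -(m₁ + m₂ + m₃) := by linear_combination h
  subst h4
  ring

/-! ## §2 The partner quadruple: pair sums `(α·a, v·w, β·a)` with `u = v²`,
`α⁴ − u(1+λ²)α² + uλ² = 0`, `β·α² = v·λ` -/

/-- Clean triple, degree 2: `e₂(partner) = u · e₂(reds)` (with `u = v²`). -/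
theorem e2_partner (a w lam v α β : ℝ) (hα : α ^ 4 - v ^ 2 * (1 + lam ^ 2) * α ^ 2 + v ^ 2 * lam ^ 2 = 0)
    (hβ : β * α ^ 2 = v * lam) (hα0 : α ≠ 0) :
    -((v * w) ^ 2 + (1 + β ^ 2) * (α * a) ^ 2) / 2 = v ^ 2 * (-(w ^ 2 + (1 + lam ^ 2) * a ^ 2) / 2) := by
  have hα2 : α ^ 2 ≠ 0 := pow_ne_zero 2 hα0
  -- (1 + β²) α² = v²(1 + λ²): multiply out using β α² = v λ and the quadratic relation for α²
  have hb2 : β ^ 2 * α ^ 4 = v ^ 2 * lam ^ 2 := by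
    have : (β * α ^ 2) ^ 2 = (v * lam) ^ 2 := by rw [hβ]
    linear_combination this
  have key : ((1 + β ^ 2) * α ^ 2) * α ^ 2 = (v ^ 2 * (1 + lam ^ 2)) * α ^ 2 := by
    linear_combination hb2 + hα
  have key' : (1 + β ^ 2) * α ^ 2 = v ^ 2 * (1 + lam ^ 2) := mul_right_cancel₀ hα2 key
  linear_combination (-(a ^ 2) / 2) * key'

/-- Clean triple, degree 3: `e₃(partner) = u · e₃(reds)`. -/
theorem e3_partner (a w lam v α β : ℝ) (hβ : β * α ^ 2 = v * lam) :
    β * (α * a) ^ 2 * (v * w) = v ^ 2 * (lam * a ^ 2 * w) := by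
  linear_combination (a ^ 2 * v * w) * hβ

/-! ## §3 The defect is a perfect square -/

/-- `e₄(partner) − u·e₄(reds) = (u(u−1)/16)·q²` with `q = w² − (1+λ²)a²`, `u = v²`. -/
theorem defect_sq (a w lam v α β : ℝ) (hα : α ^ 4 - v ^ 2 * (1 + lam ^ 2) * α ^ 2 + v ^ 2 * lam ^ 2 = 0)
    (hβ : β * α ^ 2 = v * lam) (hα0 : α ≠ 0) :
    (((v * w) ^ 2 - (1 + β ^ 2) * (α * a) ^ 2) ^ 2 - 4 * β ^ 2 * (α * a) ^ 4) / 16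
      - v ^ 2 * (((w ^ 2 - (1 + lam ^ 2) * a ^ 2) ^ 2 - 4 * lam ^ 2 * a ^ 4) / 16)
      = v ^ 2 * (v ^ 2 - 1) / 16 * (w ^ 2 - (1 + lam ^ 2) * a ^ 2) ^ 2 := by
  have hα2 : α ^ 2 ≠ 0 := pow_ne_zero 2 hα0
  have hb2 : β ^ 2 * α ^ 4 = v ^ 2 * lam ^ 2 := by
    have : (β * α ^ 2) ^ 2 = (v * lam) ^ 2 := by rw [hβ]
    linear_combination this
  have key' : (1 + β ^ 2) * α ^ 2 = v ^ 2 * (1 + lam ^ 2) := by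
    have key : ((1 + β ^ 2) * α ^ 2) * α ^ 2 = (v ^ 2 * (1 + lam ^ 2)) * α ^ 2 := by
      linear_combination hb2 + hα
    exact mul_right_cancel₀ hα2 key
  -- β²(αa)⁴ = v²λ² a⁴ and (1+β²)(αa)² = v²(1+λ²) a²
  have t1 : β ^ 2 * (α * a) ^ 4 = v ^ 2 * lam ^ 2 * a ^ 4 := by linear_combination (a ^ 4) * hb2
  have t2 : (1 + β ^ 2) * (α * a) ^ 2 = v ^ 2 * (1 + lam ^ 2) * a ^ 2 := by linear_combination (a ^ 2) * key'
  linear_combination ((1 + β ^ 2) * (α * a) ^ 2 + v ^ 2 * (1 + lam ^ 2) * a ^ 2 - 2 * (v * w) ^ 2) / 16 * t2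
    - (1 / 4 : ℝ) * t1

/-! ## §4 Coordinates: the discriminant of `q = w² − (1+λ²)a²` -/

/-- With `a = a₁y₁ + a₂y₂`, `w = w₁y₁ + w₂y₂`, the quadratic form `q = w² − (1+λ²)a²` has coefficients
`q₀ = w₁² − (1+λ²)a₁²`, `q₁ = 2(w₁w₂ − (1+λ²)a₁a₂)`, `q₂ = w₂² − (1+λ²)a₂²`, and `disc q = q₁² − 4q₀q₂
= 4(1+λ²)(a₁w₂ − a₂w₁)²`. -/
theorem disc_q (a₁ a₂ w₁ w₂ lam : ℝ) :
    (2 * (w₁ * w₂ - (1 + lam ^ 2) * a₁ * a₂)) ^ 2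
      - 4 * (w₁ ^ 2 - (1 + lam ^ 2) * a₁ ^ 2) * (w₂ ^ 2 - (1 + lam ^ 2) * a₂ ^ 2)
      = 4 * (1 + lam ^ 2) * (a₁ * w₂ - a₂ * w₁) ^ 2 := by
  ring

/-- Pointwise check that those coefficients are the coefficients of `q`: for every point `(y₁, y₂)`. -/
theorem q_coeffs (a₁ a₂ w₁ w₂ lam y₁ y₂ : ℝ) :
    (w₁ * y₁ + w₂ * y₂) ^ 2 - (1 + lam ^ 2) * (a₁ * y₁ + a₂ * y₂) ^ 2
      = (w₁ ^ 2 - (1 + lam ^ 2) * a₁ ^ 2) * y₁ ^ 2 + 2 * (w₁ * w₂ - (1 + lam ^ 2) * a₁ * a₂) * y₁ * y₂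
        + (w₂ ^ 2 - (1 + lam ^ 2) * a₂ ^ 2) * y₂ ^ 2 := by
  ring

/-! ## §5 The catalecticant of `c · q²` -/

/-- For a binary quadratic `q = q₀y₁² + q₁y₁y₂ + q₂y₂²` and a scalar `c`, the quartic `c·q²` has coefficients
`(D₀,…,D₄) = c·(q₀², 2q₀q₁, q₁² + 2q₀q₂, 2q₁q₂, q₂²)` on `y₁⁴, y₁³y₂, …`; pointwise check. -/
theorem sq_coeffs (q₀ q₁ q₂ c y₁ y₂ : ℝ) :
    c * (q₀ * y₁ ^ 2 + q₁ * y₁ * y₂ + q₂ * y₂ ^ 2) ^ 2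
      = c * q₀ ^ 2 * y₁ ^ 4 + c * (2 * q₀ * q₁) * y₁ ^ 3 * y₂ + c * (q₁ ^ 2 + 2 * q₀ * q₂) * y₁ ^ 2 * y₂ ^ 2
        + c * (2 * q₁ * q₂) * y₁ * y₂ ^ 3 + c * q₂ ^ 2 * y₂ ^ 4 := by
  ring

/-- The catalecticant `J = det [[a₀,a₁,a₂],[a₁,a₂,a₃],[a₂,a₃,a₄]]`, `(a₀, 4a₁, 6a₂, 4a₃, a₄) = (D₀,…,D₄)`, of the
quartic `c·q²` equals `−c³·disc(q)³/216`. -/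
theorem catalecticant_sq (q₀ q₁ q₂ c : ℝ) :
    let a0 := c * q₀ ^ 2
    let a1 := c * (2 * q₀ * q₁) / 4
    let a2 := c * (q₁ ^ 2 + 2 * q₀ * q₂) / 6
    let a3 := c * (2 * q₁ * q₂) / 4
    let a4 := c * q₂ ^ 2
    a0 * (a2 * a4 - a3 * a3) - a1 * (a1 * a4 - a3 * a2) + a2 * (a1 * a3 - a2 * a2)
      = -(c ^ 3) * (q₁ ^ 2 - 4 * q₀ * q₂) ^ 3 / 216 := by
  intro a0 a1 a2 a3 a4
  simp only [a0, a1, a2, a3, a4]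
  ring

/-- Assembly on the family: with `c = u(u−1)/16` and `disc q = 4(1+λ²)·det²` (`det = a₁w₂ − a₂w₁`),
`J(D)·(1 − u) = u³(1−u)⁴(1+λ²)³det⁶/13824`. -/
theorem signlaw_value (u lam det : ℝ) :
    (-(u * (u - 1) / 16) ^ 3 * (4 * (1 + lam ^ 2) * det ^ 2) ^ 3 / 216) * (1 - u)
      = u ^ 3 * (1 - u) ^ 4 * (1 + lam ^ 2) ^ 3 * det ^ 6 / 13824 := by
  ring

end identities

/-! ## §6 Positivity over `ℝ` -/

/-- The sign law ON THE FAMILY: for `u > 0`, `u ≠ 1` and `a ∦ w` (`det ≠ 0`) the value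
`u³(1−u)⁴(1+λ²)³det⁶/13824` of `J(D)·(1 − u)` is positive. -/
theorem signlaw_family_pos (u lam det : ℝ) (hu : 0 < u) (hu1 : u ≠ 1) (hdet : det ≠ 0) :
    0 < u ^ 3 * (1 - u) ^ 4 * (1 + lam ^ 2) ^ 3 * det ^ 6 / 13824 := by
  have h1 : 0 < (1 - u) ^ 4 := by
    have : (1 - u) ≠ 0 := sub_ne_zero.mpr (Ne.symm hu1)
    positivity
  have h2 : 0 < det ^ 6 := by positivity
  positivity

/-- Combined statement: `J(D)(1−u) > 0` on the family, with `J(D)(1−u)` written as in `signlaw_value`. -/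
theorem signlaw_family (u lam det : ℝ) (hu : 0 < u) (hu1 : u ≠ 1) (hdet : det ≠ 0) :
    0 < (-(u * (u - 1) / 16) ^ 3 * (4 * (1 + lam ^ 2) * det ^ 2) ^ 3 / 216) * (1 - u) := by
  rw [signlaw_value]
  exact signlaw_family_pos u lam det hu hu1 hdet

end Summit.Ventures.HSemireg.LI2CentredPairSumFamily
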